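import Summits.HodgeConjecture.HodgeConjecture.Cruxes.BlochSeedDiscOne.SeedCheckerNewtonClosure
import Summits.HodgeConjecture.HodgeConjecture.Cruxes.BlochSeedDiscOne.SeedCheckerAnisotropic
import Summits.HodgeConjecture.HodgeConjecture.Cruxes.BlochSeedDiscOne.SeedCheckerBalanced
import Summits.HodgeConjecture.HodgeConjecture.Cruxes.BlochSeedDiscOne.SeedCheckerDegree
import Summits.HodgeConjecture.HodgeConjecture.Cruxes.BlochSeedDiscOne.SeedCheckerAlphabet
import Summits.HodgeConjecture.HodgeConjecture.Cruxes.BlochSeedDiscOne.SeedCheckerFrame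
import Literature.AlgebraicGeometry.HodgeTheory.BlochSemiregularSpreadFromSubscheme
import Literature.AlgebraicTopology.SingularHomology.CupProductProofs
import HarnessLib

/-!
# Seed checker v38 — `SeedCheckerNewtonKit`: the (R4) Newton-closure doors of v23 WITH THEIR KIT HYPOTHESES
# DISCHARGED, the frame's own rational GRAM FORM replacing `FrameGram γ`, and the flag that `FrameGram γ` is a
# circularity constraint on the Weil frame (vacuous on a sheared frame)

EVIDENCE ∕ TYPED FILE, NOT A RUNG. Nothing in this file is proved toward HC ∕ HC_CM ∕ HC_AV ∕ №4 ∕ 26512 ∕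
`stmt-HodgeConjecture-18881` ∕ H2: `stub_rung_pad4_seedAt` (D-0145 token: line stmt-HodgeConjecture-18881
Cruxes/BlochSeedDiscOne/Lines/birth.lean 814a6a70c14e831a stub_rung_pad4_seedAt) is neither weakened nor specialised nor
used; no design is realised here; the file only sharpens the TYPING of the C7∕(R4) screen «is the design's clean
coordinate vector the Chern character of a module of rank `≤ r`?» (unit hsemireg-c5c8-1, MINT block A5, leftover §9(ii) of
the g26 INDEX memo, unblocked by the farm build of 2026-08-31 that built v23 `SeedCheckerNewtonClosure` and v24
`SeedCheckerAlphabet`).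

WHAT v23 LEFT AS HYPOTHESES ON THE KIT and what happens to each here (all against a `K`-balanced `h`, i.e.
`h ∈ pullbackEigenclasses … 2 (chi 1 1 1)` — the frame's `h_std` (`hStd_mem_chi`) and the stub's `h_K = symH ψ e a`
(`symH_mem_chi`) both are):
* `HPrimitive h (F.wOf μ)` (`wOf μ ∪ hʲ = 0 = hʲ ∪ wOf μ`, `j ≥ 1`) — DISCHARGED for every Weil frame and every Weil class
  (§38.1 `hPrimitive_of_mem_weil`, `hPrimitive_wOf`; v14's `pad4_wOf_cupProduct_hPow_eq_zero` are its two fields).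
* `cupPowTwo h 8 ≠ 0` — DISCHARGED for `h_std` given the kit's polarisation datum and for every `h_K` (v8
  `cupPowTwo_hStd_ne_zero` ∕ `cupPowTwo_symH_ne_zero'`; §38.1).
* `FrameGram F h γ` (`8!·(wOf μ ∪ wOf μ) = γ·|μ|²·h⁸` for all `μ`) — NOT a property of every frame: §38.4 proves that if a
  frame has a Gram constant `γ` then its SHEAR `(r₁, r₁ + r₂)` (again a `WeilFrame`: rational, Weil, independent) has NONE
  (`not_frameGram_shear`, from the anisotropy every kit provides), so v23's doors `newtonClosed_of_realisedBy` ∕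
  `newtonClosed_of_sheafSeedCheckR` ∕ `not_realisedBy_of_not_newtonClosed` are VACUOUSLY TRUE on such kits — FLAG.
  REPLACEMENT (§38.3): for every frame and every RATIONAL balanced `h` with `h⁸ ≠ 0` the top class `wOf μ ∪ wOf μ'` has a
  unique RATIONAL `h⁸`-coordinate `gram μ μ'` (`H¹⁶ = ℂ·h⁸`, v12 `exists_eq_smul_hPow8`, + `IsRationalClass.exists_rat_eq_of_smul`);
  it is a symmetric integral binary form in `(Re μ, Im μ)` with three rational KIT NUMBERS `g₁₁, g₁₂, g₂₂` (§38.3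
  `gram_eq`), `FrameGram F h γ ↔ 8!·g₁₁ = γ ∧ g₁₂ = 0 ∧ 8!·g₂₂ = γ` (`frameGram_iff`), and the degree-`8` row of (R4) reads,
  for EVERY frame, `P₈(λ(D)) + 18·8!·gram μ μ = 0` — the γ-FREE DOOR `newtonClosedNum_gram_of_realisedBy`, whose only
  remaining hypothesis is v23's named LAW `NewtonRankVanishing C` (Fulton Thm. 3.2 (a) read through `ch`); at kit level
  (`h = h_std`, frame `K.F`) NOTHING but the law is assumed (`newtonClosedNum_gram_of_realisedBy_kit`,
  `newtonClosedNum_gram_of_sheafSeedCheckR`).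
* Rows `r < k ≤ 7` never needed `γ`: `newtonP_lamQ_eq_zero_of_realisedBy` (law + balanced `h` + `h⁸ ≠ 0` only) and its
  contrapositive `not_realisedBy_of_newtonP_ne_zero` — the json screen that the three designs of record fail in degree `5`
  (v23 `records_fail_degree_five`) now closes the rank-`≤ 4` vector-bundle door with NO kit hypothesis; likewise the RANK WALL
  `not_realisedBy_of_rank_le_three'` (`μ ≠ 0` ⟹ no realising module of rank `≤ 3`).
* §38.6, THE FRAME OF RECORD: for v7.1's NORMALISED frame `(eeee + ēēēē, i(eeee − ēēēē))` the Gram-constant condition is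
  EXACTLY three top-degree identities — `FrameGram (normalisedFrame …) h γ ↔ eeee ∪ eeee = 0 ∧ ēēēē ∪ ēēēē = 0 ∧
  2·8!·(eeee ∪ ēēēē) = γ·h⁸` (`frameGram_normalisedFrame_iff`): obligation O-Gram typed; the two squares are routine
  (odd-degree anticommutativity of the `H¹`-letters, not done here), the third is MEMO-06's `∫ w_μ² = 2|μ|²` (`γ = 2`), ONE
  number of the anchor. `newtonClosed_of_realisedBy_normalisedFrame` is v23's door on the cell's own frame with everything
  but these three identities discharged.
* §38.5: the doors AT SCALE `L` (v24 `Design.realisedBy_atScale`: frame `F ∕ L⁴`, class `h ∕ L`): `HPrimitive`, `h⁸ ≠ 0`,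
  balancedness and rationality transfer (`Submodule.smul_mem`, `cupPowTwo_smul_pow`), and `FrameGram` is scale-INVARIANT
  (`frameGram_atScale`, confirming v24 §24.0 (iv) «`γ` unchanged»); so `newtonClosed_of_realisesTensorAtScale` has the
  unscaled `FrameGram F h γ` as its one kit hypothesis and `newtonP_lamQ_eq_zero_of_realisesTensorAtScale` has none.

No `instance`, no `notation`, no `set_option allowUnsafeReducibility`, no named fact introduced, 0 `sorry`; additive (no
existing declaration is restated under its old name; new names live in the sub-namespace `…SeedChecker.NewtonKit`).
Sources: v23 `SeedCheckerNewtonClosure` (§23.3–23.4), v14 `SeedCheckerAnisotropic` (§17.3–17.4), v8 `SeedCheckerBalanced`,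
v12 `SeedCheckerDegree` (§15.5), v24 `SeedCheckerAlphabet` (§24.3), v7.1 `SeedCheckerFrame` (`normalisedFrame_wOf`); [cite: Fulton1998, Thm. 3.2 (a), Example 3.2.3]
[cite: HatcherAT2002, Thm. 3.11, §3.2] [cite: VoisinHodgeI2002, §7.1.1, §11.3].
-/

noncomputable section

set_option linter.dupNamespace false

open CategoryTheory AlgebraicGeometry
open Literature.AlgebraicGeometry Literature.AlgebraicGeometry.Motives Literature.AlgebraicGeometry.HodgeTheory
open Literature.AlgebraicTopology.SingularHomology

namespace Summit.HodgeConjecture.HodgeConjecture.Cruxes.BlochSeedDiscOne.SeedChecker.NewtonKit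

open Summit.HodgeConjecture.HodgeConjecture.Cruxes.BlochSeedDiscOne.Anchor
open Summit.Ventures.HSemireg Summit.Ventures.HSemireg.Pad4Tower
open Summit.HodgeConjecture.HodgeConjecture.Cruxes.BlochSeedDiscOne.SeedChecker.NewtonClosure
open Summit.HodgeConjecture.HodgeConjecture.Cruxes.BlochSeedDiscOne.SeedChecker.Anisotropic

variable {E₀ : AbelianVariety ℂ} {ψ₀ : E₀ ⟶ E₀}

/-! ### §38.1 The kit facts v23 took as hypotheses, discharged -/

section KitFacts

/-- **every Weil class is `h`-primitive for every `K`-balanced `h`** (both orders; the two fields of v23 `HPrimitive` are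
the tree's `weil_cupProduct_hPow_eq_zero` ∕ `hPow_cupProduct_weil_eq_zero`, as in v14 §17.4). -/
theorem hPrimitive_of_mem_weil (hE : E₀.dim = 1) (hψ : ψ₀ ≫ ψ₀ = -(1 • 𝟙 E₀)) {h : complexBetti (pad4Anchor E₀).X 2}
    (hh : h ∈ pullbackEigenclasses (pad4Anchor E₀) (pad4Action E₀ ψ₀) 2 (chi 1 1 1))
    {w : complexBetti (pad4Anchor E₀).X (2 * 4)} (hw : w ∈ weilClassesOf (pad4Anchor E₀) (pad4Action E₀ ψ₀) 4 1) :
    HPrimitive h w :=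
  ⟨fun _ _ hdeg hj => Anisotropic.weil_cupProduct_hPow_eq_zero one_pos (pad4Action_comp_self hψ) (pad4Anchor_dim hE) hj hdeg hw hh,
    fun _ _ hdeg hj => Anisotropic.hPow_cupProduct_weil_eq_zero one_pos (pad4Action_comp_self hψ) (pad4Anchor_dim hE) hj hdeg hh hw⟩

/-- **the frame classes `wOf μ` are `h`-primitive** for every Weil frame, every `μ`, every balanced `h`. -/
theorem hPrimitive_wOf (hE : E₀.dim = 1) (hψ : ψ₀ ≫ ψ₀ = -(1 • 𝟙 E₀)) (F : WeilFrame E₀ ψ₀) (μ : GaussianInt)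
    {h : complexBetti (pad4Anchor E₀).X 2} (hh : h ∈ pullbackEigenclasses (pad4Anchor E₀) (pad4Action E₀ ψ₀) 2 (chi 1 1 1)) :
    HPrimitive h (F.wOf μ) :=
  hPrimitive_of_mem_weil hE hψ hh (F.wOf_mem μ)

/-- … against the frame's `h_std`. -/
theorem hPrimitive_wOf_hStd (hE : E₀.dim = 1) (hψ : ψ₀ ≫ ψ₀ = -(1 • 𝟙 E₀)) (F : WeilFrame E₀ ψ₀) (η : complexBetti E₀.X 2)
    (μ : GaussianInt) : HPrimitive (hStd E₀ η) (F.wOf μ) :=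
  hPrimitive_wOf hE hψ F μ (hStd_mem_chi hE hψ η)

/-- … against the stub's `h_K = symH ψ e a` (any `(e, a)`). -/
theorem hPrimitive_wOf_symH (hE : E₀.dim = 1) (hψ : ψ₀ ≫ ψ₀ = -(1 • 𝟙 E₀)) (F : WeilFrame E₀ ψ₀)
    (e : ProjectiveEmbedding (pad4Anchor E₀).X) (a : complexBetti (projectiveSpace e.n ℂ) 2) (μ : GaussianInt) :
    HPrimitive (symH (pad4Action E₀ ψ₀) e a) (F.wOf μ) :=
  hPrimitive_wOf hE hψ F μ (symH_mem_chi hψ e a)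

/-- **`h_std⁸ ≠ 0`** from a polarisation datum (v8, Kähler volume). -/
theorem hStd_pow_eight_ne_zero (hE : E₀.dim = 1) {η : complexBetti E₀.X 2} (P : Polarisation E₀ η) :
    cupPowTwo (hStd E₀ η) 8 ≠ 0 :=
  SeedChecker.cupPowTwo_hStd_ne_zero hE P le_rfl

/-- **`h_K⁸ ≠ 0`** for every `(e, a)`, `a` rational `≠ 0` (v8). -/
theorem symH_pow_eight_ne_zero (hE : E₀.dim = 1) (e : ProjectiveEmbedding (pad4Anchor E₀).X)
    {a : complexBetti (projectiveSpace e.n ℂ) 2} (ha : IsRationalClass a) (ha0 : a ≠ 0) :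
    cupPowTwo (symH (pad4Action E₀ ψ₀) e a) 8 ≠ 0 :=
  SeedChecker.cupPowTwo_symH_ne_zero' hE e ha ha0 le_rfl

/-- the kit's `h_std⁸ ≠ 0`. -/
theorem kit_hStd_pow_eight_ne_zero (hE : E₀.dim = 1) (K : AnchorKit E₀ ψ₀) : cupPowTwo (hStd E₀ K.η) 8 ≠ 0 :=
  hStd_pow_eight_ne_zero hE K.pol

/-- the kit's `h_K⁸ ≠ 0`. -/
theorem kit_symH_pow_eight_ne_zero (hE : E₀.dim = 1) (K : AnchorKit E₀ ψ₀) :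
    cupPowTwo (symH (pad4Action E₀ ψ₀) K.pol.e K.pol.a) 8 ≠ 0 :=
  symH_pow_eight_ne_zero hE K.pol.e K.pol.a_rational K.pol.a_ne_zero

/-- the kit's `h_std` is rational. -/
theorem kit_hStd_rational (K : AnchorKit E₀ ψ₀) : IsRationalClass (hStd E₀ K.η) :=
  hStd_rational K.η_rational

end KitFacts

/-! ### §38.2 Rows `r < k ≤ 7` of (R4) and the rank wall — no Gram hypothesis, kit facts discharged -/

section Rows

variable {C : ChernCharacterBetti} {D : Design} {F : WeilFrame E₀ ψ₀} {h : complexBetti (pad4Anchor E₀).X 2}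
  {𝓔 : (pad4Anchor E₀).X.left.Modules}

/-- **(R4@json), ROWS `r < k ≤ 7`, γ-FREE AND KIT-FREE**: under the law, a design realised by a module of rank `≤ r`
against ANY Weil frame and any balanced `h` with `h⁸ ≠ 0` has `P_k(λ(D)) = 0` for `r < k ≤ 7` — decidable integer
identities in `c₀(D), …, c₇(D)`. -/
theorem newtonP_lamQ_eq_zero_of_realisedBy (hlaw : NewtonRankVanishing C) (hE : E₀.dim = 1) (hψ : ψ₀ ≫ ψ₀ = -(1 • 𝟙 E₀))
    (hh : h ∈ pullbackEigenclasses (pad4Anchor E₀) (pad4Action E₀ ψ₀) 2 (chi 1 1 1)) (h8 : cupPowTwo h 8 ≠ 0)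
    (hR : D.RealisedBy C F h 𝓔) {r : ℕ} (hrk : HasRankLE 𝓔 r) : ∀ k : ℕ, r < k → k ≤ 7 → newtonP k (lamQ D) = 0 := by
  intro k hk hk7
  have hz := newtonP_eq_zero_of_hasRankLE hlaw hrk (cleanPowerSums_of_realisedBy hR) (hPrimitive_wOf hE hψ F D.mu hh) h8
    k hk hk7
  have hmap := cast_newtonP (lamQ D) k
  rw [show (fun i => ((lamQ D i : ℚ) : ℂ)) = lamC D from rfl, hz] at hmap
  exact_mod_cast hmap

/-- **CONTRAPOSITIVE: a design failing ONE identity `P_k(λ(D)) = 0`, `r < k ≤ 7`, is realised by NO module of rank `≤ r`**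
against any frame and any balanced `h` with `h⁸ ≠ 0` — the vector-bundle doors (v4 twisted-kernel ∕ cokernel presentations,
v2 sheaf door at rank `r`) are closed on the json BEFORE any presentation is written, with no hypothesis on the kit. -/
theorem not_realisedBy_of_newtonP_ne_zero (hlaw : NewtonRankVanishing C) (hE : E₀.dim = 1) (hψ : ψ₀ ≫ ψ₀ = -(1 • 𝟙 E₀))
    (hh : h ∈ pullbackEigenclasses (pad4Anchor E₀) (pad4Action E₀ ψ₀) 2 (chi 1 1 1)) (h8 : cupPowTwo h 8 ≠ 0)
    {r k : ℕ} (hk : r < k) (hk7 : k ≤ 7) (hfail : newtonP k (lamQ D) ≠ 0)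
    (𝓔 : (pad4Anchor E₀).X.left.Modules) (hrk : HasRankLE 𝓔 r) : ¬ D.RealisedBy C F h 𝓔 :=
  fun hR => hfail (newtonP_lamQ_eq_zero_of_realisedBy hlaw hE hψ hh h8 hR hrk k hk hk7)

/-- **THE RANK WALL, kit-free**: under the law a design with `μ ≠ 0` is realised by NO module of rank `≤ 3` (against any
frame, any balanced `h` with `h⁸ ≠ 0`; v23 `not_realisedBy_of_rank_le_three` with `HPrimitive` discharged). -/
theorem not_realisedBy_of_rank_le_three' (hlaw : NewtonRankVanishing C) (hE : E₀.dim = 1) (hψ : ψ₀ ≫ ψ₀ = -(1 • 𝟙 E₀))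
    (hh : h ∈ pullbackEigenclasses (pad4Anchor E₀) (pad4Action E₀ ψ₀) 2 (chi 1 1 1)) (h8 : cupPowTwo h 8 ≠ 0)
    (hμ : D.mu ≠ 0) (𝓔 : (pad4Anchor E₀).X.left.Modules) {r : ℕ} (hrk : HasRankLE 𝓔 r) (hr : r ≤ 3) :
    ¬ D.RealisedBy C F h 𝓔 :=
  not_realisedBy_of_rank_le_three hlaw hμ (hPrimitive_wOf hE hψ F D.mu hh) h8 𝓔 hrk hr

/-- rows `r < k ≤ 7` on the DESIGN ROAD (`h = h_std` of a polarised `η`, any frame): only the law is assumed. -/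
theorem newtonP_lamQ_eq_zero_of_realisedBy_hStd (hlaw : NewtonRankVanishing C) (hE : E₀.dim = 1)
    (hψ : ψ₀ ≫ ψ₀ = -(1 • 𝟙 E₀)) {η : complexBetti E₀.X 2} (P : Polarisation E₀ η) (hR : D.RealisedBy C F (hStd E₀ η) 𝓔)
    {r : ℕ} (hrk : HasRankLE 𝓔 r) : ∀ k : ℕ, r < k → k ≤ 7 → newtonP k (lamQ D) = 0 :=
  newtonP_lamQ_eq_zero_of_realisedBy hlaw hE hψ (hStd_mem_chi hE hψ η) (hStd_pow_eight_ne_zero hE P) hR hrk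

/-- rows `r < k ≤ 7` against the stub's `h_K = symH ψ e a` (`a` rational `≠ 0`, any frame): only the law is assumed. -/
theorem newtonP_lamQ_eq_zero_of_realisedBy_symH (hlaw : NewtonRankVanishing C) (hE : E₀.dim = 1)
    (hψ : ψ₀ ≫ ψ₀ = -(1 • 𝟙 E₀)) (e : ProjectiveEmbedding (pad4Anchor E₀).X) {a : complexBetti (projectiveSpace e.n ℂ) 2}
    (ha : IsRationalClass a) (ha0 : a ≠ 0) (hR : D.RealisedBy C F (symH (pad4Action E₀ ψ₀) e a) 𝓔) {r : ℕ}
    (hrk : HasRankLE 𝓔 r) : ∀ k : ℕ, r < k → k ≤ 7 → newtonP k (lamQ D) = 0 :=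
  newtonP_lamQ_eq_zero_of_realisedBy hlaw hE hψ (symH_mem_chi hψ e a) (symH_pow_eight_ne_zero hE e ha ha0) hR hrk

/-- **THE SHEAF DOOR (v2 `Design.SheafSeedCheckR`, realisation against the kit's `h_std`) READS ROWS `r < k ≤ 7` with NO kit
hypothesis** (v23 `newtonClosed_of_sheafSeedCheckR` needed `HPrimitive`, `FrameGram γ`, `h⁸ ≠ 0`). -/
theorem newtonP_lamQ_eq_zero_of_sheafSeedCheckR (hlaw : NewtonRankVanishing C) (hE : E₀.dim = 1)
    (hψ : ψ₀ ≫ ψ₀ = -(1 • 𝟙 E₀)) {r : ℕ} {I : Finset ℕ} {K : AnchorKit E₀ ψ₀} (hchk : D.SheafSeedCheckR r C I K 𝓔)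
    (hrk : HasRankLE 𝓔 r) : ∀ k : ℕ, r < k → k ≤ 7 → newtonP k (lamQ D) = 0 :=
  newtonP_lamQ_eq_zero_of_realisedBy_hStd hlaw hE hψ K.pol hchk.2.2.2.2 hrk

/-- the rank wall on the design road, law only. -/
theorem not_realisedBy_hStd_of_rank_le_three (hlaw : NewtonRankVanishing C) (hE : E₀.dim = 1)
    (hψ : ψ₀ ≫ ψ₀ = -(1 • 𝟙 E₀)) {η : complexBetti E₀.X 2} (P : Polarisation E₀ η) (hμ : D.mu ≠ 0)
    (𝓔 : (pad4Anchor E₀).X.left.Modules) {r : ℕ} (hrk : HasRankLE 𝓔 r) (hr : r ≤ 3) : ¬ D.RealisedBy C F (hStd E₀ η) 𝓔 :=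
  not_realisedBy_of_rank_le_three' hlaw hE hψ (hStd_mem_chi hE hψ η) (hStd_pow_eight_ne_zero hE P) hμ 𝓔 hrk hr

end Rows

/-! ### §38.3 The frame's own rational Gram form against `h⁸` and the γ-free degree-`8` door -/

section Gram

variable {h : complexBetti (pad4Anchor E₀).X 2}

/-- **the cup product of two RATIONAL middle classes is a RATIONAL multiple of `h⁸`** (`h` rational, `h⁸ ≠ 0`): `H¹⁶ = ℂ·h⁸`
(v12 `exists_eq_smul_hPow8`) and a complex multiple of the non-zero rational class `h⁸` is rational only for a rational
multiplier (`IsRationalClass.exists_rat_eq_of_smul`). -/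
theorem exists_rat_cup_eq_smul_hPow8 (hE : E₀.dim = 1) (hhr : IsRationalClass h) (h8 : cupPowTwo h 8 ≠ 0)
    {x y : complexBetti (pad4Anchor E₀).X (2 * 4)} (hx : IsRationalClass x) (hy : IsRationalClass y) :
    ∃ q : ℚ, cupProduct d448 x y = ((q : ℚ) : ℂ) • cupPowTwo h 8 := by
  obtain ⟨c, hc⟩ := exists_eq_smul_hPow8 hE h8 (cupProduct d448 x y)
  have hrat : IsRationalClass (c • cupPowTwo h 8) := hc ▸ hx.cup d448 hy
  obtain ⟨q, rfl⟩ := IsRationalClass.exists_rat_eq_of_smul (hhr.cupPowTwo 8) h8 hrat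
  exact ⟨q, hc⟩

/-- the `h⁸`-coordinate is unique. -/
theorem rat_smul_hPow8_injective (h8 : cupPowTwo h 8 ≠ 0) {q q' : ℚ}
    (hq : ((q : ℚ) : ℂ) • cupPowTwo h 8 = ((q' : ℚ) : ℂ) • cupPowTwo h 8) : q = q' := by
  exact_mod_cast smul_left_injective ℂ h8 hq

/-- **THE GRAM FORM OF A WEIL FRAME against `h`**: the rational `h⁸`-coordinate `gram μ μ'` of `wOf μ ∪ wOf μ'` (a KIT datum:
frame- and `h`-dependent, design-independent). -/
def gram (hE : E₀.dim = 1) (F : WeilFrame E₀ ψ₀) (hhr : IsRationalClass h) (h8 : cupPowTwo h 8 ≠ 0)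
    (μ μ' : GaussianInt) : ℚ :=
  (exists_rat_cup_eq_smul_hPow8 hE hhr h8 (F.wOf_rational μ) (F.wOf_rational μ')).choose

theorem gram_spec (hE : E₀.dim = 1) (F : WeilFrame E₀ ψ₀) (hhr : IsRationalClass h) (h8 : cupPowTwo h 8 ≠ 0)
    (μ μ' : GaussianInt) :
    cupProduct d448 (F.wOf μ) (F.wOf μ') = ((gram hE F hhr h8 μ μ' : ℚ) : ℂ) • cupPowTwo h 8 :=
  (exists_rat_cup_eq_smul_hPow8 hE hhr h8 (F.wOf_rational μ) (F.wOf_rational μ')).choose_spec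

/-- the Gram form is characterised by its defining equation. -/
theorem gram_eq_of_eq (hE : E₀.dim = 1) (F : WeilFrame E₀ ψ₀) (hhr : IsRationalClass h) (h8 : cupPowTwo h 8 ≠ 0)
    {μ μ' : GaussianInt} {q : ℚ} (hq : cupProduct d448 (F.wOf μ) (F.wOf μ') = ((q : ℚ) : ℂ) • cupPowTwo h 8) :
    gram hE F hhr h8 μ μ' = q :=
  rat_smul_hPow8_injective h8 ((gram_spec hE F hhr h8 μ μ').symm.trans hq)

/-- the three GRAM NUMBERS of the frame: `g₁₁ = gram 1 1` (`r₁ ∪ r₁`), `g₂₂ = gram i i` (`r₂ ∪ r₂`), `g₁₂ = gram 1 i`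
(`r₁ ∪ r₂`; `= gram i 1` by graded commutativity, `gram_symm`). Here `i = ⟨0, 1⟩ ∈ ℤ[i]`. -/
def gaussI : GaussianInt := ⟨0, 1⟩

@[simp] theorem gaussI_re : gaussI.re = 0 := rfl
@[simp] theorem gaussI_im : gaussI.im = 1 := rfl

theorem wOf_one (F : WeilFrame E₀ ψ₀) : F.wOf 1 = F.rOne := by
  rw [WeilFrame.wOf, Zsqrtd.re_one, Zsqrtd.im_one, Int.cast_one, Int.cast_zero, Rat.cast_one, Rat.cast_zero, one_smul,
    zero_smul, add_zero]

theorem wOf_gaussI (F : WeilFrame E₀ ψ₀) : F.wOf gaussI = F.rTwo := by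
  rw [WeilFrame.wOf, gaussI_re, gaussI_im, Int.cast_one, Int.cast_zero, Rat.cast_one, Rat.cast_zero, one_smul,
    zero_smul, zero_add]

/-- **bilinear expansion of `wOf μ ∪ wOf μ'` on the frame** (`wOf μ = Re μ·r₁ + Im μ·r₂`). -/
theorem cup_wOf_wOf_expand (F : WeilFrame E₀ ψ₀) (μ μ' : GaussianInt) :
    cupProduct d448 (F.wOf μ) (F.wOf μ') =
      ((μ.re : ℚ) : ℂ) • ((μ'.re : ℚ) : ℂ) • cupProduct d448 F.rOne F.rOne +
        ((μ.re : ℚ) : ℂ) • ((μ'.im : ℚ) : ℂ) • cupProduct d448 F.rOne F.rTwo +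
        (((μ.im : ℚ) : ℂ) • ((μ'.re : ℚ) : ℂ) • cupProduct d448 F.rTwo F.rOne +
        ((μ.im : ℚ) : ℂ) • ((μ'.im : ℚ) : ℂ) • cupProduct d448 F.rTwo F.rTwo) := by
  simp only [WeilFrame.wOf, map_add, map_smul, LinearMap.add_apply, LinearMap.smul_apply, smul_add]
  module

/-- **graded commutativity in even degree: `x ∪ y = y ∪ x` on `H⁸`** (Hatcher Thm. 3.11, the tree's
`cupProduct_gradedComm_holds`; `(-1)^{8·8} = 1`). -/
theorem cup_comm_deg8 (x y : complexBetti (pad4Anchor E₀).X (2 * 4)) : cupProduct d448 x y = cupProduct d448 y x := by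
  have hc := cupProduct_gradedComm_holds ℂ (ComplexPoints (pad4Anchor E₀).X) d448 d448 x y
  rw [hc]
  norm_num

/-- the Gram form is symmetric. -/
theorem gram_symm (hE : E₀.dim = 1) (F : WeilFrame E₀ ψ₀) (hhr : IsRationalClass h) (h8 : cupPowTwo h 8 ≠ 0)
    (μ μ' : GaussianInt) : gram hE F hhr h8 μ μ' = gram hE F hhr h8 μ' μ :=
  gram_eq_of_eq hE F hhr h8 ((cup_comm_deg8 _ _).trans (gram_spec hE F hhr h8 μ' μ))

/-- **THE GRAM FORM IS THE INTEGRAL BINARY FORM `g₁₁·Re μ Re μ' + g₁₂·(Re μ Im μ' + Im μ Re μ') + g₂₂·Im μ Im μ'`** in the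
frame's three Gram numbers. -/
theorem gram_eq (hE : E₀.dim = 1) (F : WeilFrame E₀ ψ₀) (hhr : IsRationalClass h) (h8 : cupPowTwo h 8 ≠ 0)
    (μ μ' : GaussianInt) :
    gram hE F hhr h8 μ μ' =
      gram hE F hhr h8 1 1 * (μ.re * μ'.re) + gram hE F hhr h8 1 gaussI * (μ.re * μ'.im + μ.im * μ'.re) +
        gram hE F hhr h8 gaussI gaussI * (μ.im * μ'.im) := by
  apply gram_eq_of_eq hE F hhr h8
  have h11 := gram_spec hE F hhr h8 1 1
  have h12 := gram_spec hE F hhr h8 1 gaussI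
  have h21 := gram_spec hE F hhr h8 gaussI 1
  have h22 := gram_spec hE F hhr h8 gaussI gaussI
  rw [gram_symm hE F hhr h8 gaussI 1] at h21
  rw [wOf_one] at h11 h12 h21
  rw [wOf_gaussI] at h12 h21 h22
  rw [cup_wOf_wOf_expand, h11, h12, h21, h22]
  simp only [smul_smul, ← add_smul]
  congr 1
  push_cast
  ring

/-- **THE GRAM FORM IN THE UNIT `∫ h⁸ = 8!`** (`gram8 μ = 8!·gram μ μ`), the quantity v23's `FrameGram γ` prescribes to be
`γ·|μ|²`. -/
def gram8 (hE : E₀.dim = 1) (F : WeilFrame E₀ ψ₀) (hhr : IsRationalClass h) (h8 : cupPowTwo h 8 ≠ 0) (μ : GaussianInt) : ℚ :=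
  40320 * gram hE F hhr h8 μ μ

theorem gram8_spec (hE : E₀.dim = 1) (F : WeilFrame E₀ ψ₀) (hhr : IsRationalClass h) (h8 : cupPowTwo h 8 ≠ 0)
    (μ : GaussianInt) :
    (40320 : ℂ) • cupProduct d448 (F.wOf μ) (F.wOf μ) = ((gram8 hE F hhr h8 μ : ℚ) : ℂ) • cupPowTwo h 8 := by
  rw [gram_spec hE F hhr h8 μ μ, smul_smul, gram8]
  push_cast
  rfl

/-- **`FrameGram F h γ` ⟺ `gram8 μ = γ·|μ|²` for all `μ`** (for rational balanced `h`, `h⁸ ≠ 0`). -/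
theorem frameGram_iff_gram8 (hE : E₀.dim = 1) (F : WeilFrame E₀ ψ₀) (hhr : IsRationalClass h) (h8 : cupPowTwo h 8 ≠ 0)
    (γ : ℚ) : FrameGram F h γ ↔ ∀ μ : GaussianInt, gram8 hE F hhr h8 μ = γ * (μ.norm : ℚ) := by
  unfold FrameGram
  refine forall_congr' fun μ => ?_
  change (40320 : ℂ) • cupProduct d448 (F.wOf μ) (F.wOf μ) = _ ↔ _
  rw [gram8_spec hE F hhr h8 μ]
  exact ⟨fun hμ => rat_smul_hPow8_injective h8 hμ, fun hμ => by rw [hμ]⟩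

/-- **`FrameGram` IS A PREDICATE ON THREE KIT NUMBERS: `FrameGram F h γ ↔ 8!·g₁₁ = γ ∧ g₁₂ = 0 ∧ 8!·g₂₂ = γ`** — the frame's
Gram matrix against `h⁸∕8!` must be the SCALAR `γ`; any frame with `g₁₂ ≠ 0` or `g₁₁ ≠ g₂₂` has NO Gram constant. -/
theorem frameGram_iff (hE : E₀.dim = 1) (F : WeilFrame E₀ ψ₀) (hhr : IsRationalClass h) (h8 : cupPowTwo h 8 ≠ 0) (γ : ℚ) :
    FrameGram F h γ ↔ 40320 * gram hE F hhr h8 1 1 = γ ∧ gram hE F hhr h8 1 gaussI = 0 ∧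
      40320 * gram hE F hhr h8 gaussI gaussI = γ := by
  have n1 : (((1 : GaussianInt).norm : ℤ) : ℚ) = 1 := by simp [Zsqrtd.norm_def]
  have ni : (((gaussI).norm : ℤ) : ℚ) = 1 := by simp [Zsqrtd.norm_def, gaussI]
  have n1i : (((1 + gaussI : GaussianInt).norm : ℤ) : ℚ) = 2 := by norm_num [Zsqrtd.norm_def, gaussI]
  have r1i : (((1 + gaussI : GaussianInt).re : ℤ) : ℚ) = 1 := by simp [gaussI]
  have i1i : (((1 + gaussI : GaussianInt).im : ℤ) : ℚ) = 1 := by simp [gaussI]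
  rw [frameGram_iff_gram8 hE F hhr h8 γ]
  constructor
  · intro hall
    have h1 := hall 1
    have hi := hall gaussI
    have h1i := hall (1 + gaussI)
    rw [gram8, n1] at h1
    rw [gram8, ni] at hi
    rw [gram8, n1i, gram_eq hE F hhr h8 (1 + gaussI) (1 + gaussI), r1i, i1i] at h1i
    refine ⟨by linarith, by linarith, by linarith⟩
  · rintro ⟨h11, h12, h22⟩ μ
    rw [gram8, gram_eq hE F hhr h8 μ μ, h12, Zsqrtd.norm_def]
    push_cast
    linear_combination (μ.re * μ.re : ℚ) * h11 + (μ.im * μ.im : ℚ) * h22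

variable {C : ChernCharacterBetti} {D : Design} {F : WeilFrame E₀ ψ₀} {𝓔 : (pad4Anchor E₀).X.left.Modules}

/-- **THE γ-FREE DOOR — (R4) FOR EVERY WEIL FRAME, ALL KIT HYPOTHESES DISCHARGED**: under the law, a design realised by a
module of rank `≤ r` against any frame `F` and any RATIONAL balanced `h` with `h⁸ ≠ 0` passes the numerical closure
`NewtonClosedNum r 1 (λ(D)) (gram8 μ(D))`, i.e. `P_k(λ(D)) = 0` (`r < k ≤ 7`) and `P₈(λ(D)) + 18·gram8 μ(D) = 0` (`r < 8`),
where `gram8 μ = 8!·(g₁₁ Re² + 2 g₁₂ Re·Im + g₂₂ Im²)(μ)` is the frame's OWN Gram form (`gram_eq`). For a frame with Gram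
constant `γ` this is v23's `NewtonClosed D r γ` (`newtonClosed_iff_of_frameGram`). -/
theorem newtonClosedNum_gram_of_realisedBy (hlaw : NewtonRankVanishing C) (hE : E₀.dim = 1) (hψ : ψ₀ ≫ ψ₀ = -(1 • 𝟙 E₀))
    (hh : h ∈ pullbackEigenclasses (pad4Anchor E₀) (pad4Action E₀ ψ₀) 2 (chi 1 1 1)) (hhr : IsRationalClass h)
    (h8 : cupPowTwo h 8 ≠ 0) (hR : D.RealisedBy C F h 𝓔) {r : ℕ} (hrk : HasRankLE 𝓔 r) :
    NewtonClosedNum r 1 (lamQ D) (gram8 hE F hhr h8 D.mu) :=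
  newtonClosedNum_of_cleanPowerSums hlaw hrk (lamQ D) (cleanPowerSums_of_realisedBy hR) (hPrimitive_wOf hE hψ F D.mu hh) h8
    (by rw [one_mul]; exact gram8_spec hE F hhr h8 D.mu)

/-- … spelled out at rank `4`: `P₅ = P₆ = P₇ = 0 ∧ P₈ + 18·gram8 μ(D) = 0`. -/
theorem newton_four_gram_of_realisedBy (hlaw : NewtonRankVanishing C) (hE : E₀.dim = 1) (hψ : ψ₀ ≫ ψ₀ = -(1 • 𝟙 E₀))
    (hh : h ∈ pullbackEigenclasses (pad4Anchor E₀) (pad4Action E₀ ψ₀) 2 (chi 1 1 1)) (hhr : IsRationalClass h)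
    (h8 : cupPowTwo h 8 ≠ 0) (hR : D.RealisedBy C F h 𝓔) (hrk : HasRankLE 𝓔 4) :
    newtonP5 (lamQ D) = 0 ∧ newtonP6 (lamQ D) = 0 ∧ newtonP7 (lamQ D) = 0 ∧
      newtonP8 (lamQ D) + 18 * gram8 hE F hhr h8 D.mu = 0 := by
  have h4 := (newtonClosedNum_four_iff 1 (lamQ D) _).1 (newtonClosedNum_gram_of_realisedBy hlaw hE hψ hh hhr h8 hR hrk)
  simpa only [mul_one, one_mul] using h4

/-- under a Gram constant the γ-free closure IS v23's: `NewtonClosed D r γ ↔ NewtonClosedNum r 1 λ(D) (gram8 μ(D))`. -/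
theorem newtonClosed_iff_of_frameGram (hE : E₀.dim = 1) (hhr : IsRationalClass h) (h8 : cupPowTwo h 8 ≠ 0) {γ : ℚ}
    (hγ : FrameGram F h γ) (D : Design) (r : ℕ) :
    NewtonClosed D r γ ↔ NewtonClosedNum r 1 (lamQ D) (gram8 hE F hhr h8 D.mu) := by
  have hμ := (frameGram_iff_gram8 hE F hhr h8 γ).1 hγ D.mu
  unfold NewtonClosed NewtonClosedNum
  rw [hμ]
  constructor <;> rintro ⟨h1, h2⟩ <;> refine ⟨h1, fun hr => ?_⟩ <;> have h2' := h2 hr <;> linarith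

/-- **KIT LEVEL, DESIGN ROAD: NOTHING BUT THE LAW IS ASSUMED** — realisation against the kit's `(K.F, h_std)` by a module of
rank `≤ r` ⟹ the γ-free closure with the kit's own Gram form. -/
theorem newtonClosedNum_gram_of_realisedBy_kit (hlaw : NewtonRankVanishing C) (hE : E₀.dim = 1)
    (hψ : ψ₀ ≫ ψ₀ = -(1 • 𝟙 E₀)) (K : AnchorKit E₀ ψ₀) (hR : D.RealisedBy C K.F (hStd E₀ K.η) 𝓔) {r : ℕ}
    (hrk : HasRankLE 𝓔 r) :
    NewtonClosedNum r 1 (lamQ D) (gram8 hE K.F (kit_hStd_rational K) (kit_hStd_pow_eight_ne_zero hE K) D.mu) :=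
  newtonClosedNum_gram_of_realisedBy hlaw hE hψ (hStd_mem_chi hE hψ K.η) (kit_hStd_rational K)
    (kit_hStd_pow_eight_ne_zero hE K) hR hrk

/-- **THE SHEAF DOOR READS THE γ-FREE CLOSURE, law only** (v23 `newtonClosed_of_sheafSeedCheckR` minus its three kit
hypotheses). -/
theorem newtonClosedNum_gram_of_sheafSeedCheckR (hlaw : NewtonRankVanishing C) (hE : E₀.dim = 1)
    (hψ : ψ₀ ≫ ψ₀ = -(1 • 𝟙 E₀)) {r : ℕ} {I : Finset ℕ} {K : AnchorKit E₀ ψ₀} (hchk : D.SheafSeedCheckR r C I K 𝓔)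
    (hrk : HasRankLE 𝓔 r) :
    NewtonClosedNum r 1 (lamQ D) (gram8 hE K.F (kit_hStd_rational K) (kit_hStd_pow_eight_ne_zero hE K) D.mu) :=
  newtonClosedNum_gram_of_realisedBy_kit hlaw hE hψ K hchk.2.2.2.2 hrk

/-- **v23's OWN DOOR WITH TWO OF ITS THREE KIT HYPOTHESES DISCHARGED** (only `FrameGram` remains; see §38.4 for why it
cannot be discharged for an arbitrary frame). -/
theorem newtonClosed_of_realisedBy' (hlaw : NewtonRankVanishing C) (hE : E₀.dim = 1) (hψ : ψ₀ ≫ ψ₀ = -(1 • 𝟙 E₀))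
    (hh : h ∈ pullbackEigenclasses (pad4Anchor E₀) (pad4Action E₀ ψ₀) 2 (chi 1 1 1)) (h8 : cupPowTwo h 8 ≠ 0) {γ : ℚ}
    (hγ : FrameGram F h γ) (hR : D.RealisedBy C F h 𝓔) {r : ℕ} (hrk : HasRankLE 𝓔 r) : NewtonClosed D r γ :=
  newtonClosed_of_realisedBy hlaw hR hrk (hPrimitive_wOf hE hψ F D.mu hh) hγ h8

/-- the sheaf door with a Gram constant on the kit's frame: law + `FrameGram` only. -/
theorem newtonClosed_of_sheafSeedCheckR' (hlaw : NewtonRankVanishing C) (hE : E₀.dim = 1) (hψ : ψ₀ ≫ ψ₀ = -(1 • 𝟙 E₀))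
    {r : ℕ} {γ : ℚ} {I : Finset ℕ} {K : AnchorKit E₀ ψ₀} (hchk : D.SheafSeedCheckR r C I K 𝓔) (hrk : HasRankLE 𝓔 r)
    (hγ : FrameGram K.F (hStd E₀ K.η) γ) : NewtonClosed D r γ :=
  newtonClosed_of_realisedBy' hlaw hE hψ (hStd_mem_chi hE hψ K.η) (kit_hStd_pow_eight_ne_zero hE K) hγ hchk.2.2.2.2 hrk

end Gram

/-! ### §38.4 FLAG: `FrameGram γ` is a circularity constraint — a sheared frame has no Gram constant -/

section Shear

/-- **THE SHEARED FRAME `(r₁, r₁ + r₂)`** — again a Weil frame (rational, Weil, `ℂ`-independent): `WeilFrame` is an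
interface for ANY rational basis of the Weil plane, so this is as legitimate a kit frame as `(r₁, r₂)`. -/
def shear (F : WeilFrame E₀ ψ₀) : WeilFrame E₀ ψ₀ where
  rOne := F.rOne
  rTwo := F.rOne + F.rTwo
  rOne_rational := F.rOne_rational
  rTwo_rational := F.rOne_rational.add F.rTwo_rational
  rOne_mem := F.rOne_mem
  rTwo_mem := Submodule.add_mem _ F.rOne_mem F.rTwo_mem
  indep s t hst := by
    have hst' : (s + t) • F.rOne + t • F.rTwo = 0 := by
      rw [add_smul, add_assoc, ← smul_add]
      exact hst
    obtain ⟨h1, h2⟩ := F.indep (s + t) t hst'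
    refine ⟨?_, h2⟩
    rwa [h2, add_zero] at h1

@[simp] theorem shear_rOne (F : WeilFrame E₀ ψ₀) : (shear F).rOne = F.rOne := rfl
@[simp] theorem shear_rTwo (F : WeilFrame E₀ ψ₀) : (shear F).rTwo = F.rOne + F.rTwo := rfl

/-- the sheared frame's classes: `wOf' μ = wOf (Re μ + Im μ, Im μ)`. -/
theorem shear_wOf (F : WeilFrame E₀ ψ₀) (μ : GaussianInt) : (shear F).wOf μ = F.wOf ⟨μ.re + μ.im, μ.im⟩ := by
  change ((μ.re : ℚ) : ℂ) • F.rOne + ((μ.im : ℚ) : ℂ) • (F.rOne + F.rTwo) =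
    (((μ.re + μ.im : ℤ) : ℚ) : ℂ) • F.rOne + ((μ.im : ℚ) : ℂ) • F.rTwo
  push_cast
  rw [smul_add, add_smul]
  abel

theorem shear_wOf_one (F : WeilFrame E₀ ψ₀) : (shear F).wOf 1 = F.wOf 1 := by
  rw [shear_wOf]
  rfl

theorem shear_wOf_gaussI (F : WeilFrame E₀ ψ₀) : (shear F).wOf gaussI = F.wOf (1 + gaussI) := by
  rw [shear_wOf]
  rfl

variable {h : complexBetti (pad4Anchor E₀).X 2}

/-- a Gram constant reads `8!·(wOf μ ∪ wOf μ)` as `γ·|μ|²·h⁸`; two such readings of the same class agree. -/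
theorem frameGram_coeff_eq (h8 : cupPowTwo h 8 ≠ 0) {x : complexBetti (pad4Anchor E₀).X (2 * 8)} {a b : ℚ}
    (ha : x = ((a : ℚ) : ℂ) • cupPowTwo h 8) (hb : x = ((b : ℚ) : ℂ) • cupPowTwo h 8) : a = b :=
  rat_smul_hPow8_injective h8 (ha.symm.trans hb)

/-- **FLAG — `FrameGram` IS VACUOUS OFF THE CIRCULAR FRAMES: if a Weil frame has a Gram constant `γ` against `h` (`h⁸ ≠ 0`),
its SHEAR has NO Gram constant at all**, as soon as the Weil plane is anisotropic (which every kit provides, v14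
`weilAnisotropic_of_kit`). Proof: `μ = 1` gives `γ' = γ`, `μ = i` gives `γ' = 2γ`, so `γ = 0`, so `r₁ ∪ r₁ = 0`, contradicting
anisotropy. Hence v23's doors quantified over `FrameGram K.F h γ` say nothing for such kits; the frame-general statement is
§38.3's γ-free door. -/
theorem not_frameGram_shear (hW : WeilAnisotropic E₀ ψ₀) (F : WeilFrame E₀ ψ₀) (h8 : cupPowTwo h 8 ≠ 0) {γ : ℚ}
    (hγ : FrameGram F h γ) (γ' : ℚ) : ¬ FrameGram (shear F) h γ' := by
  intro hγ'
  have n1 : (((1 : GaussianInt).norm : ℤ) : ℚ) = 1 := by simp [Zsqrtd.norm_def]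
  have ni : (((gaussI).norm : ℤ) : ℚ) = 1 := by simp [Zsqrtd.norm_def, gaussI]
  have n1i : (((1 + gaussI : GaussianInt).norm : ℤ) : ℚ) = 2 := by norm_num [Zsqrtd.norm_def, gaussI]
  have e1 : γ * (((1 : GaussianInt).norm : ℤ) : ℚ) = γ' * (((1 : GaussianInt).norm : ℤ) : ℚ) := by
    refine frameGram_coeff_eq h8 (hγ 1) ?_
    have h' := hγ' 1
    rw [shear_wOf_one] at h'
    exact h'
  have e2 : γ * (((1 + gaussI : GaussianInt).norm : ℤ) : ℚ) = γ' * (((gaussI).norm : ℤ) : ℚ) := by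
    refine frameGram_coeff_eq h8 (hγ (1 + gaussI)) ?_
    have h' := hγ' gaussI
    rw [shear_wOf_gaussI] at h'
    exact h'
  rw [n1] at e1
  rw [n1i, ni] at e2
  have hγ0 : γ = 0 := by linarith
  have h0 := hγ 1
  rw [hγ0, zero_mul, Rat.cast_zero, zero_smul, smul_eq_zero] at h0
  have hsq : cupProduct d448 (F.wOf 1) (F.wOf 1) = 0 := h0.resolve_left (by norm_num)
  exact one_ne_zero ((wOf_sq_eq_zero_iff hW F 1).1 hsq)

/-- **kit form of the flag**: for every anchor kit `K` and every `h` with `h⁸ ≠ 0`, a Gram constant for `K.F` forbids one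
for the sheared kit frame — so `FrameGram` singles out a class of frames and is a genuine (decidable-on-three-numbers,
`frameGram_iff`) CHECK ON THE KIT, not a fact about kits. -/
theorem not_frameGram_shear_of_kit (hE : E₀.dim = 1) (hψ : ψ₀ ≫ ψ₀ = -(1 • 𝟙 E₀)) (K : AnchorKit E₀ ψ₀)
    (h8 : cupPowTwo h 8 ≠ 0) {γ : ℚ} (hγ : FrameGram K.F h γ) (γ' : ℚ) : ¬ FrameGram (shear K.F) h γ' :=
  not_frameGram_shear (weilAnisotropic_of_kit hE hψ K) K.F h8 hγ γ'

/-- and a Gram constant is never `0` (anisotropy): `FrameGram F h γ → γ ≠ 0`. -/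
theorem frameGram_ne_zero (hW : WeilAnisotropic E₀ ψ₀) (F : WeilFrame E₀ ψ₀) {γ : ℚ} (hγ : FrameGram F h γ) : γ ≠ 0 := by
  rintro rfl
  have h0 := hγ 1
  rw [zero_mul, Rat.cast_zero, zero_smul, smul_eq_zero] at h0
  have hsq : cupProduct d448 (F.wOf 1) (F.wOf 1) = 0 := h0.resolve_left (by norm_num)
  exact one_ne_zero ((wOf_sq_eq_zero_iff hW F 1).1 hsq)

end Shear

/-! ### §38.5 The doors at scale `L` (v24 `Design.realisedBy_atScale`: frame `F ∕ L⁴`, class `h ∕ L`) -/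

section Scale

variable {h : complexBetti (pad4Anchor E₀).X 2}

/-- `(c • h)⁸ ≠ 0` for `c ≠ 0`. -/
theorem cupPowTwo_smul_ne_zero {c : ℂ} (hc : c ≠ 0) (h8 : cupPowTwo h 8 ≠ 0) : cupPowTwo (c • h) 8 ≠ 0 := by
  rw [cupPowTwo_smul_pow]
  exact smul_ne_zero (pow_ne_zero 8 hc) h8

theorem invScale_cast_ne_zero {L : ℕ} (hL : L ≠ 0) : ((invScale L : ℚ) : ℂ) ≠ 0 :=
  Rat.cast_ne_zero.2 (invScale_ne_zero hL)

/-- `h ∕ L` is balanced when `h` is. -/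
theorem smul_mem_chi (hh : h ∈ pullbackEigenclasses (pad4Anchor E₀) (pad4Action E₀ ψ₀) 2 (chi 1 1 1)) (c : ℂ) :
    c • h ∈ pullbackEigenclasses (pad4Anchor E₀) (pad4Action E₀ ψ₀) 2 (chi 1 1 1) :=
  Submodule.smul_mem _ c hh

/-- `h ∕ L` is rational when `h` is. -/
theorem ratCast_smul_rational (hhr : IsRationalClass h) (q : ℚ) : IsRationalClass (((q : ℚ) : ℂ) • h) :=
  hhr.smul q

/-- **`FrameGram` IS SCALE-INVARIANT: `FrameGram F h γ → FrameGram (F ∕ L⁴) (h ∕ L) γ`** (both sides of the defining identity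
scale by `L⁻⁸`) — v24 §24.0 (iv) «`γ` unchanged», typed. -/
theorem frameGram_atScale (F : WeilFrame E₀ ψ₀) {γ : ℚ} (hγ : FrameGram F h γ) {L : ℕ} (hL : L ≠ 0) :
    FrameGram (F.atScale L hL) (((invScale L : ℚ) : ℂ) • h) γ := by
  intro μ
  have e1 : cupProduct (rfl : 2 * 4 + 2 * 4 = 2 * 8) ((F.atScale L hL).wOf μ) ((F.atScale L hL).wOf μ) =
      ((((invScale L ^ 4 : ℚ)) : ℂ) * (((invScale L ^ 4 : ℚ)) : ℂ)) •
        cupProduct (rfl : 2 * 4 + 2 * 4 = 2 * 8) (F.wOf μ) (F.wOf μ) := by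
    rw [WeilFrame.wOf_atScale, LinearMap.map_smul₂, map_smul, smul_smul]
  rw [e1, smul_comm (40320 : ℂ), hγ μ, cupPowTwo_smul_pow, smul_smul, smul_smul]
  congr 1
  push_cast
  ring

/-- **v23's DOOR AT SCALE `L` with `HPrimitive` and `h⁸ ≠ 0` discharged and `FrameGram` transported**: an (A1)-clean design
realised AT SCALE `L` through a word frame linked to `(F, h)` (v24), by a module of rank `≤ r`, passes `NewtonClosed D r γ` —
hypotheses: the law, `h` balanced with `h⁸ ≠ 0`, and the UNSCALED `FrameGram F h γ`. -/
theorem newtonClosed_of_realisesTensorAtScale {C : ChernCharacterBetti} (hlaw : NewtonRankVanishing C) (hE : E₀.dim = 1)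
    (hψ : ψ₀ ≫ ψ₀ = -(1 • 𝟙 E₀)) (hh : h ∈ pullbackEigenclasses (pad4Anchor E₀) (pad4Action E₀ ψ₀) 2 (chi 1 1 1))
    (h8 : cupPowTwo h 8 ≠ 0) {F : WeilFrame E₀ ψ₀} {γ : ℚ} (hγ : FrameGram F h γ) {D : Design} {Φ : WordFrame E₀}
    {𝓔 : (pad4Anchor E₀).X.left.Modules} {L : ℕ} (hL : L ≠ 0) (hΦ : Φ.LinksTo F h) (hD : D.Clean)
    (hR : RealisesTensorAtScale C Φ 𝓔 L D.wch) {r : ℕ} (hrk : HasRankLE 𝓔 r) : NewtonClosed D r γ :=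
  newtonClosed_of_realisedBy hlaw (D.realisedBy_atScale hL hΦ hD hR) hrk
    (hPrimitive_wOf hE hψ (F.atScale L hL) D.mu (smul_mem_chi hh _)) (frameGram_atScale F hγ hL)
    (cupPowTwo_smul_ne_zero (invScale_cast_ne_zero hL) h8)

/-- **rows `r < k ≤ 7` AT SCALE `L`, NO kit hypothesis**: law + balanced `h` with `h⁸ ≠ 0`. -/
theorem newtonP_lamQ_eq_zero_of_realisesTensorAtScale {C : ChernCharacterBetti} (hlaw : NewtonRankVanishing C)
    (hE : E₀.dim = 1) (hψ : ψ₀ ≫ ψ₀ = -(1 • 𝟙 E₀))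
    (hh : h ∈ pullbackEigenclasses (pad4Anchor E₀) (pad4Action E₀ ψ₀) 2 (chi 1 1 1)) (h8 : cupPowTwo h 8 ≠ 0)
    {F : WeilFrame E₀ ψ₀} {D : Design} {Φ : WordFrame E₀} {𝓔 : (pad4Anchor E₀).X.left.Modules} {L : ℕ} (hL : L ≠ 0)
    (hΦ : Φ.LinksTo F h) (hD : D.Clean) (hR : RealisesTensorAtScale C Φ 𝓔 L D.wch) {r : ℕ} (hrk : HasRankLE 𝓔 r) :
    ∀ k : ℕ, r < k → k ≤ 7 → newtonP k (lamQ D) = 0 :=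
  newtonP_lamQ_eq_zero_of_realisedBy hlaw hE hψ (smul_mem_chi hh _) (cupPowTwo_smul_ne_zero (invScale_cast_ne_zero hL) h8)
    (D.realisedBy_atScale hL hΦ hD hR) hrk

/-- **the γ-free closure AT SCALE `L`** for rational balanced `h` (the Gram form is taken against the rescaled pair
`(F ∕ L⁴, h ∕ L)`; it equals the unscaled one, `gram_atScale`). -/
theorem newtonClosedNum_gram_of_realisesTensorAtScale {C : ChernCharacterBetti} (hlaw : NewtonRankVanishing C)
    (hE : E₀.dim = 1) (hψ : ψ₀ ≫ ψ₀ = -(1 • 𝟙 E₀))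
    (hh : h ∈ pullbackEigenclasses (pad4Anchor E₀) (pad4Action E₀ ψ₀) 2 (chi 1 1 1)) (hhr : IsRationalClass h)
    (h8 : cupPowTwo h 8 ≠ 0) {F : WeilFrame E₀ ψ₀} {D : Design} {Φ : WordFrame E₀} {𝓔 : (pad4Anchor E₀).X.left.Modules}
    {L : ℕ} (hL : L ≠ 0) (hΦ : Φ.LinksTo F h) (hD : D.Clean) (hR : RealisesTensorAtScale C Φ 𝓔 L D.wch) {r : ℕ}
    (hrk : HasRankLE 𝓔 r) :
    NewtonClosedNum r 1 (lamQ D)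
      (gram8 hE (F.atScale L hL) (ratCast_smul_rational hhr (invScale L))
        (cupPowTwo_smul_ne_zero (invScale_cast_ne_zero hL) h8) D.mu) :=
  newtonClosedNum_gram_of_realisedBy hlaw hE hψ (smul_mem_chi hh _) (ratCast_smul_rational hhr (invScale L))
    (cupPowTwo_smul_ne_zero (invScale_cast_ne_zero hL) h8) (D.realisedBy_atScale hL hΦ hD hR) hrk

/-- **the Gram form is scale-invariant**: `gram (F ∕ L⁴) (h ∕ L) = gram F h`. -/
theorem gram_atScale (hE : E₀.dim = 1) (F : WeilFrame E₀ ψ₀) (hhr : IsRationalClass h) (h8 : cupPowTwo h 8 ≠ 0) {L : ℕ}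
    (hL : L ≠ 0) (μ μ' : GaussianInt) :
    gram hE (F.atScale L hL) (ratCast_smul_rational hhr (invScale L)) (cupPowTwo_smul_ne_zero (invScale_cast_ne_zero hL) h8)
        μ μ' = gram hE F hhr h8 μ μ' := by
  apply gram_eq_of_eq
  rw [WeilFrame.wOf_atScale, WeilFrame.wOf_atScale, LinearMap.map_smul₂, map_smul, smul_smul, gram_spec hE F hhr h8 μ μ',
    smul_smul, cupPowTwo_smul_pow, smul_smul]
  congr 1
  push_cast
  ring

end Scale


/-! ### §38.6 The frame of record: `FrameGram` for the NORMALISED frame `(eeee + ēēēē, i(eeee − ēēēē))` (v7.1) is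
exactly «both squares vanish and `2·8!·(eeee ∪ ēēēē) = γ·h⁸`» — obligation O-Gram typed as three top-degree identities -/

section RecordFrame

variable (hE : E₀.dim = 1) (hψ : ψ₀ ≫ ψ₀ = -(1 • 𝟙 E₀)) {v : complexBetti E₀.X 1} (hv : IsRationalClass v) (hv0 : v ≠ 0)

/-- `r₁ ∪ r₁ = e∪e + 2·e∪ē + ē∪ē` (`e = eeee`, `ē = ēēēē`; `ē∪e = e∪ē` by `cup_comm_deg8`). -/
theorem normalisedFrame_rOne_sq :
    cupProduct d448 (normalisedFrame hE hψ hv hv0).rOne (normalisedFrame hE hψ hv hv0).rOne =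
      cupProduct d448 (eeee ψ₀ v) (eeee ψ₀ v) + (2 : ℂ) • cupProduct d448 (eeee ψ₀ v) (eeeeBar ψ₀ v) +
        cupProduct d448 (eeeeBar ψ₀ v) (eeeeBar ψ₀ v) := by
  simp only [normalisedFrame_rOne, map_add, LinearMap.add_apply]
  rw [cup_comm_deg8 (eeeeBar ψ₀ v) (eeee ψ₀ v)]
  module

/-- `r₂ ∪ r₂ = −e∪e + 2·e∪ē − ē∪ē` (`i² = −1`). -/
theorem normalisedFrame_rTwo_sq :
    cupProduct d448 (normalisedFrame hE hψ hv hv0).rTwo (normalisedFrame hE hψ hv hv0).rTwo =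
      -cupProduct d448 (eeee ψ₀ v) (eeee ψ₀ v) + (2 : ℂ) • cupProduct d448 (eeee ψ₀ v) (eeeeBar ψ₀ v) -
        cupProduct d448 (eeeeBar ψ₀ v) (eeeeBar ψ₀ v) := by
  simp only [normalisedFrame_rTwo, map_sub, map_smul, LinearMap.sub_apply, LinearMap.smul_apply]
  rw [cup_comm_deg8 (eeeeBar ψ₀ v) (eeee ψ₀ v)]
  linear_combination (norm := module) Complex.I_mul_I • (cupProduct d448 (eeee ψ₀ v) (eeee ψ₀ v) -
    (2 : ℂ) • cupProduct d448 (eeee ψ₀ v) (eeeeBar ψ₀ v) + cupProduct d448 (eeeeBar ψ₀ v) (eeeeBar ψ₀ v))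

/-- `r₁ ∪ r₂ = i·(e∪e − ē∪ē)`. -/
theorem normalisedFrame_rOne_rTwo :
    cupProduct d448 (normalisedFrame hE hψ hv hv0).rOne (normalisedFrame hE hψ hv hv0).rTwo =
      Complex.I • (cupProduct d448 (eeee ψ₀ v) (eeee ψ₀ v) - cupProduct d448 (eeeeBar ψ₀ v) (eeeeBar ψ₀ v)) := by
  simp only [normalisedFrame_rOne, normalisedFrame_rTwo, map_add, map_sub, map_smul, LinearMap.add_apply]
  rw [cup_comm_deg8 (eeeeBar ψ₀ v) (eeee ψ₀ v)]
  module

/-- **O-Gram FOR THE FRAME OF RECORD, TYPED: `FrameGram (normalisedFrame …) h γ ↔ eeee ∪ eeee = 0 ∧ ēēēē ∪ ēēēē = 0 ∧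
2·8!·(eeee ∪ ēēēē) = γ·h⁸`** (rational balanced `h`, `h⁸ ≠ 0`). The two squares vanish by odd-degree anticommutativity of the
sixteen `H¹`-letters (routine, not done here); the third identity is MEMO-06's `∫ w_μ² = 2|μ|²`, i.e. `γ = 2` iff
`8!·(eeee ∪ ēēēē) = h⁸` — ONE top-degree number of the anchor, the residual content of v23's `FrameGram 2`. -/
theorem frameGram_normalisedFrame_iff {h : complexBetti (pad4Anchor E₀).X 2} (hhr : IsRationalClass h)
    (h8 : cupPowTwo h 8 ≠ 0) (γ : ℚ) :
    FrameGram (normalisedFrame hE hψ hv hv0) h γ ↔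
      cupProduct d448 (eeee ψ₀ v) (eeee ψ₀ v) = 0 ∧ cupProduct d448 (eeeeBar ψ₀ v) (eeeeBar ψ₀ v) = 0 ∧
        (80640 : ℂ) • cupProduct d448 (eeee ψ₀ v) (eeeeBar ψ₀ v) = ((γ : ℚ) : ℂ) • cupPowTwo h 8 := by
  have h11 := gram_spec hE (normalisedFrame hE hψ hv hv0) hhr h8 1 1
  have h12 := gram_spec hE (normalisedFrame hE hψ hv hv0) hhr h8 1 gaussI
  have h22 := gram_spec hE (normalisedFrame hE hψ hv hv0) hhr h8 gaussI gaussI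
  rw [wOf_one] at h11 h12
  rw [wOf_gaussI] at h12 h22
  rw [normalisedFrame_rOne_sq] at h11
  rw [normalisedFrame_rOne_rTwo] at h12
  rw [normalisedFrame_rTwo_sq] at h22
  rw [frameGram_iff hE (normalisedFrame hE hψ hv hv0) hhr h8 γ]
  constructor
  · rintro ⟨hg11, hg12, hg22⟩
    have hgeq : gram hE (normalisedFrame hE hψ hv hv0) hhr h8 1 1 = gram hE (normalisedFrame hE hψ hv hv0) hhr h8 gaussI gaussI := by
      linarith
    rw [hg12, Rat.cast_zero, zero_smul, smul_eq_zero] at h12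
    have hAC : cupProduct d448 (eeee ψ₀ v) (eeee ψ₀ v) - cupProduct d448 (eeeeBar ψ₀ v) (eeeeBar ψ₀ v) = 0 :=
      h12.resolve_left Complex.I_ne_zero
    rw [← hgeq, ← h11] at h22
    have hA : cupProduct d448 (eeee ψ₀ v) (eeee ψ₀ v) = 0 := by
      linear_combination (norm := module) (-(4 : ℂ)⁻¹) • h22 + (2 : ℂ)⁻¹ • hAC
    have hC : cupProduct d448 (eeeeBar ψ₀ v) (eeeeBar ψ₀ v) = 0 := by
      linear_combination (norm := module) (-(4 : ℂ)⁻¹) • h22 - (2 : ℂ)⁻¹ • hAC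
    refine ⟨hA, hC, ?_⟩
    rw [hA, hC, zero_add, add_zero] at h11
    rw [← hg11, Rat.cast_mul, mul_smul, ← h11, smul_smul]
    norm_num
  · rintro ⟨hA, hC, hB⟩
    rw [hA, hC, zero_add, add_zero] at h11
    rw [hA, hC, sub_self, smul_zero] at h12
    rw [hA, hC, neg_zero, zero_add, sub_zero] at h22
    have hg11 : 40320 * gram hE (normalisedFrame hE hψ hv hv0) hhr h8 1 1 = γ := by
      apply rat_smul_hPow8_injective h8
      rw [Rat.cast_mul, mul_smul, ← h11, smul_smul, ← hB]
      norm_num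
    have hg22 : 40320 * gram hE (normalisedFrame hE hψ hv hv0) hhr h8 gaussI gaussI = γ := by
      apply rat_smul_hPow8_injective h8
      rw [Rat.cast_mul, mul_smul, ← h22, smul_smul, ← hB]
      norm_num
    have hg12 : gram hE (normalisedFrame hE hψ hv hv0) hhr h8 1 gaussI = 0 := by
      have h0 := h12.symm
      rw [smul_eq_zero] at h0
      exact_mod_cast h0.resolve_right h8
    exact ⟨hg11, hg12, hg22⟩

/-- hence for the frame of record the γ-free degree-`8` row reads `P₈(λ(D)) + 18·γ·|μ|² = 0` with `γ` THE number
`2·8!·deg_h(eeee ∪ ēēēē)` as soon as the two squares vanish — v23's `NewtonClosed D r γ` door with every kit hypothesis but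
these three top-degree identities discharged. -/
theorem newtonClosed_of_realisedBy_normalisedFrame {C : ChernCharacterBetti} (hlaw : NewtonRankVanishing C)
    {h : complexBetti (pad4Anchor E₀).X 2} (hh : h ∈ pullbackEigenclasses (pad4Anchor E₀) (pad4Action E₀ ψ₀) 2 (chi 1 1 1))
    (hhr : IsRationalClass h) (h8 : cupPowTwo h 8 ≠ 0) {γ : ℚ}
    (hA : cupProduct d448 (eeee ψ₀ v) (eeee ψ₀ v) = 0) (hC : cupProduct d448 (eeeeBar ψ₀ v) (eeeeBar ψ₀ v) = 0)
    (hB : (80640 : ℂ) • cupProduct d448 (eeee ψ₀ v) (eeeeBar ψ₀ v) = ((γ : ℚ) : ℂ) • cupPowTwo h 8)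
    {D : Design} {𝓔 : (pad4Anchor E₀).X.left.Modules} (hR : D.RealisedBy C (normalisedFrame hE hψ hv hv0) h 𝓔) {r : ℕ}
    (hrk : HasRankLE 𝓔 r) : NewtonClosed D r γ :=
  newtonClosed_of_realisedBy' hlaw hE hψ hh h8
    ((frameGram_normalisedFrame_iff hE hψ hv hv0 hhr h8 γ).2 ⟨hA, hC, hB⟩) hR hrk

end RecordFrame

end Summit.HodgeConjecture.HodgeConjecture.Cruxes.BlochSeedDiscOne.SeedChecker.NewtonKit

end
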